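import Mathlib
import Literature.AlgebraicGeometry.HodgeTheory.WeilClasses
import Literature.AlgebraicGeometry.Motives.HyperbolicWeilType
import Literature.AlgebraicGeometry.Motives.PrymVariety
import Literature.AlgebraicGeometry.Motives.FamiliesVHS
import Summits.HodgeConjecture.HodgeConjecture.Theses.PadicSemiregularLift
import Summits.HodgeConjecture.HodgeConjecture.Theses.TropicalCuspLift

/-!
# Sketch — crux `HodgeAbelianVarieties` (stmt-HodgeConjecture-1333), round 2, ideator 4

First lemma of the crux idea `prym-canonical-z3-split-seeds`, typed over existing declarations.

* `WeilAlgebraicFor`, `WeilAlgebraicHyperbolic`, `WeilAlgebraicAll` — sector statements (same binder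
  shapes as the round-1 sketches of this crux and as route `TropicalCuspLift`).
* `PrymSeedTransport d` — the transport statement the Prym-canonical seeds are meant to PROVE:
  variational Hodge for smooth projective families of abelian EIGHTFOLDS of hyperbolic (= split)
  `ℚ(√-d)`-Weil type from the points of an anchor set `P` (intended: the 12-dimensional locus of Pryms of
  étale cyclic triple covers of genus-5 curves, d = 3, where Schoen's split canonical loci are explicit
  algebraic 4-cycles with non-zero Weil component). Over-approximation: the codimension-4 content
  ("P has codimension 4 in the base") is informal until dimensions of constructible subsets are available.
* `allSixfolds_of_splitEightfolds` — the logical spine split eightfolds ⟹ (descending) all sixfolds,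
  PROVED (one line), and the link to the tree item `TropicalCuspLift.WeilSixfolds`.
-/

namespace Summit.HodgeConjecture.HodgeConjecture.Cruxes.HodgeAbelianVarieties.IdeatorFourR2

open CategoryTheory AlgebraicGeometry
open Literature.AlgebraicGeometry Literature.AlgebraicGeometry.Motives
  Literature.AlgebraicGeometry.HodgeTheory

/-- Weil classes of `(A, φ)` (`φ ≫ φ = -d`) in half-dimension `n` are algebraic. -/
def WeilAlgebraicFor (n d : ℕ) (A : AbelianVariety ℂ) (φ : A ⟶ A) : Prop :=
  ∀ c ∈ weilClassesOf A φ n d, IsRationalClass c → IsOfHodgeType (2 * n) A.X (2 * n) n n c →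
    c ∈ algebraicClasses A.X n

/-- All `2n`-dimensional `ℚ(√-d)`-Weil pairs. -/
def WeilAlgebraicAll (n d : ℕ) : Prop :=
  ∀ (A : AbelianVariety ℂ) (φ : A ⟶ A), A.dim = 2 * n → φ ≫ φ = -((d : ℤ) • 𝟙 A) →
    WeilAlgebraicFor n d A φ

/-- The SPLIT (= hyperbolic) sector in dimension `2n`. -/
def WeilAlgebraicHyperbolic (n d : ℕ) : Prop :=
  ∀ (A : AbelianVariety ℂ) (φ : A ⟶ A) (h : complexBetti A.X 2), A.dim = 2 * n →
    φ ≫ φ = -((d : ℤ) • 𝟙 A) → IsRationalClass h → IsOfHodgeType (2 * n) A.X 2 1 1 h →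
      IsHyperbolicWeilType A φ n h → WeilAlgebraicFor n d A φ

/-- DESCENDING (Schoen 1998 addendum §10 = Koike 2004 Thm 2.1 = Markman survey §11.5 Step 2; known in
print; the e-step line's `stub_descend` at `n = 3`): split `(2n+2)`-folds give every discriminant in
dimension `2n`. Stated as the `Prop` the line consumes. -/
def Descend (n d : ℕ) : Prop := WeilAlgebraicHyperbolic (n + 1) d → WeilAlgebraicAll n d

local notation3 (prettyPrint := false) "Res[" f ", " s ", " k ", " A "]" =>
  complexBetti.map (Motives.fiberι f s) k A

/-- `PrymSeedTransport d`: for every smooth projective family `f : 𝒳 ⟶ S` of relative dimension `8`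
over an irreducible base whose fibres are abelian eightfolds, every global class `W ∈ H⁸(𝒳(ℂ);ℂ)`
that is fibrewise a rational `(4,4)`-class, and every ANCHOR SET `P ⊆ S(ℂ)` containing a point whose
fibre is a hyperbolic `ℚ(√-d)`-Weil eightfold: if `W|_{𝒳_s}` is algebraic for every `s ∈ P` then it is
algebraic for every `s`. INTENDED INSTANCE (informal content of the card): `d = 3`, `S` = a component of
the hyperbolic Weil-eightfold locus, `P` = the (12-dimensional, codimension-4) image of the Prym map of
étale cyclic triple covers of genus-5 curves, where `W|_{𝒳_s}` is algebraic by Schoen's split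
canonical loci; the proof route is Bloch/Buchweitz–Flenner semiregularity of those loci with effective
obstruction space `ker π` against the 4 normal directions. As typed (arbitrary non-empty `P`) this is
variational Hodge for hyperbolic Weil eightfold families — an OVER-approximation recorded honestly. -/
def PrymSeedTransport (d : ℕ) : Prop :=
  ∀ (𝒳 S : SchemeOver ℂ) (f : 𝒳 ⟶ S), IsSmoothProjectiveFamily f (2 * 4) →
    IrreducibleSpace S.left →
    (∀ s : ComplexPoints S, ∃ B : AbelianVariety ℂ, B.dim = 2 * 4 ∧ Nonempty (B.X ≅ fiberOver f s)) →
    ∀ (W : complexBetti 𝒳 (2 * 4)),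
      (∀ s, IsRationalClass (Res[f, s, 2 * 4, W]) ∧
        IsOfHodgeType (2 * 4) (fiberOver f s) (2 * 4) 4 4 (Res[f, s, 2 * 4, W])) →
      ∀ (P : Set (ComplexPoints S)),
        (∃ s₀ ∈ P, ∃ (A : AbelianVariety ℂ) (φ : A ⟶ A) (h : complexBetti A.X 2) (e : A.X ≅ fiberOver f s₀),
          A.dim = 2 * 4 ∧ φ ≫ φ = -((d : ℤ) • 𝟙 A) ∧ IsRationalClass h ∧ IsHyperbolicWeilType A φ 4 h) →
        (∀ s ∈ P, Res[f, s, 2 * 4, W] ∈ algebraicClasses (fiberOver f s) 4) →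
        ∀ s, Res[f, s, 2 * 4, W] ∈ algebraicClasses (fiberOver f s) 4

/-- `PrymAnchoredFamilies d`: every Weil class `c` on every hyperbolic `ℚ(√-d)`-Weil eightfold
`(A, φ, h)` is the restriction of a fibrewise-Hodge global class `W` of a smooth projective family of
abelian eightfolds over an irreducible base which carries an ANCHOR SET `P` (with a hyperbolic witness)
on which `W` is fibrewise algebraic. INTENDED INSTANCE: the universal family over the hyperbolic
Weil-eightfold component through `A` (a Shimura family; `W` exists by the theorem of the fixed part
since the Weil plane is monodromy-invariant) and `P` = its Prym locus (Pryms of étale cyclic triple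
covers `C₁₃ → C₅`, `d = 3`), where `W|_P` is algebraic by SCHOEN'S SPLIT CANONICAL LOCI — the classes of
the three components of `Nm⁻¹|K_{C₅}| ∩ {h⁰ ≥ 1} ⊂ S⁸C₁₃` pushed to the Prym span `ℚθ⁴ ⊕ W` (Schoen
1988 for genus 3; van Geemen LNM 1594 §7.3 for genus 4; genus 5 = the card's first computation). -/
def PrymAnchoredFamilies (d : ℕ) : Prop :=
  ∀ (A : AbelianVariety ℂ) (φ : A ⟶ A) (h : complexBetti A.X 2), A.dim = 2 * 4 →
    φ ≫ φ = -((d : ℤ) • 𝟙 A) → IsRationalClass h → IsHyperbolicWeilType A φ 4 h →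
    ∀ c ∈ weilClassesOf A φ 4 d, IsRationalClass c → IsOfHodgeType (2 * 4) A.X (2 * 4) 4 4 c →
      ∃ (𝒳 S : SchemeOver ℂ) (f : 𝒳 ⟶ S) (_ : IsSmoothProjectiveFamily f (2 * 4))
        (_ : IrreducibleSpace S.left)
        (_ : ∀ s : ComplexPoints S, ∃ B : AbelianVariety ℂ, B.dim = 2 * 4 ∧ Nonempty (B.X ≅ fiberOver f s))
        (W : complexBetti 𝒳 (2 * 4))
        (_ : ∀ s, IsRationalClass (Res[f, s, 2 * 4, W]) ∧
          IsOfHodgeType (2 * 4) (fiberOver f s) (2 * 4) 4 4 (Res[f, s, 2 * 4, W]))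
        (s₁ : ComplexPoints S) (e : A.X ≅ fiberOver f s₁)
        (_ : complexBetti.map e.hom (2 * 4) (Res[f, s₁, 2 * 4, W]) = c)
        (P : Set (ComplexPoints S)),
        (∃ s₀ ∈ P, ∃ (A₀ : AbelianVariety ℂ) (φ₀ : A₀ ⟶ A₀) (h₀ : complexBetti A₀.X 2)
            (_ : A₀.X ≅ fiberOver f s₀),
          A₀.dim = 2 * 4 ∧ φ₀ ≫ φ₀ = -((d : ℤ) • 𝟙 A₀) ∧ IsRationalClass h₀ ∧ IsHyperbolicWeilType A₀ φ₀ 4 h₀) ∧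
        ∀ s ∈ P, Res[f, s, 2 * 4, W] ∈ algebraicClasses (fiberOver f s) 4

/-- Iso-invariance of `algebraicClasses` along an isomorphism of `ℂ`-schemes (proved in the crux's
Disproof work file, `stub5c_algebraicClasses_map_iso`; carried as a hypothesis here). -/
def AlgebraicClassesIsoInvariant : Prop :=
  ∀ (B : AbelianVariety ℂ) (Y : SchemeOver ℂ) (e : B.X ≅ Y) (p : ℕ) (y : complexBetti Y (2 * p)),
    y ∈ algebraicClasses Y p → complexBetti.map e.hom (2 * p) y ∈ algebraicClasses B.X p

/-- FIRST LEMMA (proved plumbing; the mathematical weight sits in the two hypotheses): Prym-anchored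
families (Schoen seeds on the Prym locus) + seed transport off the Prym locus ⟹ Weil classes on all
SPLIT `ℚ(√-3)` eightfolds. -/
theorem weilAlgebraicHyperbolic_four_three_of_prymSeeds (hIso : AlgebraicClassesIsoInvariant)
    (hA : PrymAnchoredFamilies 3) (hT : PrymSeedTransport 3) : WeilAlgebraicHyperbolic 4 3 := by
  intro A φ h hdim hφ hh _ hhyp c hc hcr hcH
  obtain ⟨𝒳, S, f, hf, hirr, hfib, W, hW, s₁, e, hec, P, hP, halg⟩ :=
    hA A φ h hdim hφ hh hhyp c hc hcr hcH
  have hall := hT 𝒳 S f hf hirr hfib W hW P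
    (by
      obtain ⟨s₀, hs₀, A₀, φ₀, h₀, e₀, h1, h2, h3, h4⟩ := hP
      exact ⟨s₀, hs₀, A₀, φ₀, h₀, e₀, h1, h2, h3, h4⟩) halg s₁
  rw [← hec]
  exact hIso A _ e 4 _ hall

/-- SPINE (proved): split `ℚ(√-d)` eightfolds + descending ⟹ every `ℚ(√-d)` sixfold, all
discriminants — the named open case of the crux (arXiv:2603.20268 §1) for `d = 3` (resp. `d = 1`). -/
theorem allSixfolds_of_splitEightfolds (n d : ℕ) (hE : WeilAlgebraicHyperbolic (n + 1) d)
    (hD : Descend n d) : WeilAlgebraicAll n d :=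
  hD hE

/-- Link to the crux: the crux gives the sixfold sector outright (so the line attacks a statement BELOW
the crux, as every Weil-sector line must; cf. Disproof `weilItems_of`). -/
theorem weilAlgebraicAll_of_crux
    (h : Summit.HodgeConjecture.HodgeConjecture.Theses.PadicSemiregularLift.HodgeAbelianVarieties)
    (n d : ℕ) : WeilAlgebraicAll n d := by
  intro A φ hA _ c _ hc hH
  have h2 := (h A).2 n c
  rw [hA] at h2
  exact h2 hc hH

end Summit.HodgeConjecture.HodgeConjecture.Cruxes.HodgeAbelianVarieties.IdeatorFourR2
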